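import Summits.RiemannHypothesis.RiemannHypothesis.Theorems.SoloBlindTrigPolyDivision

/-!
# SoloBlind artefact 31 — THEOREM K reduces to its circle-rooted case by peeling minima
(`paper/window-height.md` §12.10.3 (i)(a′); claims C73, C119)

Context (soloist `solo-RiemannHypothesis-blind`, session s55).  THEOREM K of the report is the sharp total-variation
bound `∫₀^{2π}|T′| ≤ (2n/π)∫₀^{2π}T` for every nonnegative real trigonometric polynomial `T` of degree `≤ n` (equality at
`1 + cos nθ`; LEMMA Ψ*, its last step, is kernel theorem `soloBlind_psiStar_nonneg` of artefact 30).  Step (a) of the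
report's proof reduces THEOREM K to CIRCLE-ROOTED polynomials `T(x) = c·∏_{i<k}(1 − cos(x − θ_i))` (all roots of the
Fejér–Riesz factor on the unit circle) and was argued in prose through Fejér–Riesz factorisation, convexity of
`T ↦ ∫|T′|` on the cone of nonnegative trigonometric polynomials and a Bauer-maximum-principle / extreme-ray description
of that cone.  THIS FILE replaces step (a) by an elementary PEELING ARGUMENT, kernel-checked, that uses neither
Fejér–Riesz nor Choquet–Bauer theory:

 (1) DIVISION (`soloBlind_trigPoly_divide`): every real trigonometric polynomial `f` of degree `≤ d+1` is
     `f(x) = (1 − cos x)·g(x) + α + β·sin x` with `g` of degree `≤ d`; the quotients `F_m = (1 − cos mx)/(1 − cos x)` and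
     `G_m = (sin mx − m·sin x)/(1 − cos x)` are trigonometric polynomials of degree `m − 1` generated by the three-term
     recurrences `F_{m+2} = 2cos x·F_{m+1} − F_m + 2`, `G_{m+2} = 2cos x·G_{m+1} − G_m − 2(m+1)·sin x`
     (`soloBlind_divQuotients`, support file).
 (2) FACTOR AT A ZERO (`soloBlind_trigPoly_factor_zero`): if moreover `f ≥ 0` and `f(x₀) = 0`, then
     `f(x) = (1 − cos(x − x₀))·g(x)` with `g ≥ 0` of degree `≤ d`: after translating `x₀` to `0`, `α = f(x₀) = 0`,
     `β = f′(x₀) = 0` (first-order condition at a minimum, `IsLocalMin.hasDerivAt_eq_zero`), and `g ≥ 0` off the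
     countable zero set of `1 − cos`, hence everywhere by continuity (`Set.Countable.dense_compl`).
 (3) PEELING (`soloBlind_tv_peel`): for `U ≥ 0` of degree `≤ j+1` subtract its minimum value `m = U(x₀) ≥ 0` (attained, by
     periodicity and compactness) and factor `U − m`: then `P_θ·U = P_{(x₀,θ)}·W + m·P_θ` with `W ≥ 0` of degree `≤ j`
     and one more factor in the root product `P_θ(x) = ∏_i (1 − cos(x − θ_i))`; subadditivity
     `∫|(F+G)′| ≤ ∫|F′| + ∫|G′|` (`soloBlind_tv_add_le`), `∫|(m·P)′| = m·∫|P′|` and induction on `j` reduce everything to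
     pure root products with `k ≤ n` factors, where the hypothesis applies (`2k/π ≤ 2n/π`, `∫P_θ ≥ 0`).

Main theorem `soloBlind_theoremK_of_circleRooted`: if `∫₀^{2π}|P_θ′| ≤ (2k/π)∫₀^{2π}P_θ` for every root product with
`k ≤ n` factors, then `∫₀^{2π}|T′| ≤ (2n/π)∫₀^{2π}T` for every `T ≥ 0` given by coefficients of degree `≤ n`.  Hence
THEOREM K in degrees `≤ n` is equivalent to its circle-rooted instances in degrees `≤ n` (the converse is the special
case `T = P_θ`), and the only analytic input still outside the kernel is the circle-rooted inequality
`Σ_{local maxima} P_θ(x_k) ≤ 2k·mean(P_θ)` (report §12.10.3 (i)(c)–(g)).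
Step (1) and the closure algebra of the property "`f` is pointwise a trigonometric polynomial of degree `≤ d`" (an
explicit `∃ ac bc, ∀ y, f y = Σ …`, spelled out in every statement; no definition) live in the support file
`SoloBlindTrigPolyDivision.lean` (artefact 31a); this file holds the analytic half: periodicity, continuity,
derivatives and attained minima of trigonometric polynomials, the factor lemma (2), the total-variation lemmas and the
peeling induction (3).  Mathlib + artefact 31a only; no sorries; no new definitions.
-/

open Finset Real

namespace Summit.RiemannHypothesis.RiemannHypothesis.Theorems

/-! Throughout, "`f` is a trigonometric polynomial of degree `≤ d`" is the explicit statement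
`∃ ac bc : ℕ → ℝ, ∀ y, f y = ∑ l ∈ range (d + 1), (ac l * cos (l * y) + bc l * sin (l * y))`
(written out in every signature: no definition or notation is introduced). -/

namespace SoloBlindTrigPoly

/-- `2π`-periodicity. -/
theorem periodic {d : ℕ} {f : ℝ → ℝ} (hf : (∃ ac bc : ℕ → ℝ, ∀ y, f y
    = ∑ l ∈ range (d + 1), (ac l * cos (l * y) + bc l * sin (l * y)))) : Function.Periodic f (2 * π) := by
  obtain ⟨a, b, hf⟩ := hf
  intro x
  rw [hf, hf]
  refine Finset.sum_congr rfl fun m _ => ?_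
  have : (m : ℝ) * (x + 2 * π) = m * x + m * (2 * π) := by ring
  rw [this, cos_add_nat_mul_two_pi, sin_add_nat_mul_two_pi]

/-- Continuity. -/
theorem continuous {d : ℕ} {f : ℝ → ℝ} (hf : (∃ ac bc : ℕ → ℝ, ∀ y, f y
    = ∑ l ∈ range (d + 1), (ac l * cos (l * y) + bc l * sin (l * y)))) : Continuous f := by
  obtain ⟨a, b, hf⟩ := hf
  rw [show f = _ from funext hf]
  exact continuous_finsetSum _ fun m _ => by fun_prop

/-- Term-wise differentiation of a coefficient representation. -/
theorem hasDerivAt {d : ℕ} {f : ℝ → ℝ} {a b : ℕ → ℝ}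
    (hf : ∀ x, f x = ∑ m ∈ range (d + 1), (a m * cos (m * x) + b m * sin (m * x))) (x : ℝ) :
    HasDerivAt f (∑ m ∈ range (d + 1), ((b m * m) * cos (m * x) + (-(a m * m)) * sin (m * x))) x := by
  rw [show f = _ from funext hf]
  apply HasDerivAt.fun_sum
  intro m _
  have hlin : HasDerivAt (fun y : ℝ => (m : ℝ) * y) m x := by
    simpa using (hasDerivAt_id x).const_mul (m : ℝ)
  have hc : HasDerivAt (fun y : ℝ => cos (m * y)) (-sin (m * x) * m) x :=
    (hasDerivAt_cos (m * x)).comp x hlin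
  have hs : HasDerivAt (fun y : ℝ => sin (m * y)) (cos (m * x) * m) x :=
    (hasDerivAt_sin (m * x)).comp x hlin
  have h2 : HasDerivAt (fun y => a m * cos (m * y) + b m * sin (m * y))
      (a m * (-sin (m * x) * m) + b m * (cos (m * x) * m)) x :=
    (hc.const_mul (a m)).add (hs.const_mul (b m))
  exact h2.congr_deriv (by ring)

/-- Differentiability. -/
theorem differentiable {d : ℕ} {f : ℝ → ℝ} (hf : (∃ ac bc : ℕ → ℝ, ∀ y, f y
    = ∑ l ∈ range (d + 1), (ac l * cos (l * y) + bc l * sin (l * y)))) : Differentiable ℝ f := by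
  obtain ⟨a, b, hf⟩ := hf
  exact fun x => (hasDerivAt hf x).differentiableAt

/-- The derivative of a trigonometric polynomial is one of the same degree. -/
theorem deriv {d : ℕ} {f : ℝ → ℝ} (hf : (∃ ac bc : ℕ → ℝ, ∀ y, f y
    = ∑ l ∈ range (d + 1), (ac l * cos (l * y) + bc l * sin (l * y)))) :
    (∃ ac bc : ℕ → ℝ, ∀ y, (_root_.deriv f) y
        = ∑ l ∈ range (d + 1), (ac l * cos (l * y) + bc l * sin (l * y))) := by
  obtain ⟨a, b, hf⟩ := hf
  exact ⟨fun m => b m * m, fun m => -(a m * m), fun x => (hasDerivAt hf x).deriv⟩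

/-- The derivative is continuous. -/
theorem continuous_deriv {d : ℕ} {f : ℝ → ℝ} (hf : (∃ ac bc : ℕ → ℝ, ∀ y, f y
    = ∑ l ∈ range (d + 1), (ac l * cos (l * y) + bc l * sin (l * y)))) :
    Continuous (_root_.deriv f) := SoloBlindTrigPoly.continuous (deriv hf)

/-- A trigonometric polynomial attains a global minimum. -/
theorem exists_forall_le {d : ℕ} {f : ℝ → ℝ} (hf : (∃ ac bc : ℕ → ℝ, ∀ y, f y
    = ∑ l ∈ range (d + 1), (ac l * cos (l * y) + bc l * sin (l * y)))) :
    ∃ x₀, ∀ x, f x₀ ≤ f x := by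
  have hc := continuous hf
  obtain ⟨x₀, _, hmin⟩ := isCompact_Icc.exists_isMinOn (Set.nonempty_Icc.mpr Real.two_pi_pos.le)
    (hc.continuousOn (s := Set.Icc 0 (2 * π)))
  refine ⟨x₀, fun x => ?_⟩
  obtain ⟨y, hy, hfy⟩ := (periodic hf).exists_mem_Ico₀ Real.two_pi_pos x
  rw [hfy]
  exact (isMinOn_iff.mp hmin) y (Set.Ico_subset_Icc_self hy)

/-- The product `∏_{i<k} (1 − cos(x − θ_i)) · U(x)` is a trigonometric polynomial
of degree `≤ k + j`. -/
theorem rootProduct_mul {j : ℕ} {U : ℝ → ℝ} (hU : (∃ ac bc : ℕ → ℝ, ∀ y, U y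
    = ∑ l ∈ range (j + 1), (ac l * cos (l * y) + bc l * sin (l * y)))) :
    ∀ (k : ℕ) (θ : Fin k → ℝ),
      (∃ ac bc : ℕ → ℝ, ∀ y, (fun x => (∏ i, (1 - cos (x - θ i))) * U x) y
          = ∑ l ∈ range (k + j + 1), (ac l * cos (l * y) + bc l * sin (l * y))) := by
  intro k
  induction k with
  | zero => intro θ; simpa using hU
  | succ k ih =>
    intro θ
    have h := mul_rootFactor (ih (fun i => θ i.succ)) (θ 0)
    have hkj : k + j + 1 = k + 1 + j := by omega
    rw [hkj] at h
    have e : (fun x => (∏ i, (1 - cos (x - θ i))) * U x)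
        = fun x => (1 - cos (x - θ 0)) * ((∏ i : Fin k, (1 - cos (x - θ i.succ))) * U x) := by
      funext x; rw [Fin.prod_univ_succ]; ring
    rw [e]; exact h

/-- A root product with `k` factors has degree `≤ k`. -/
theorem rootProduct (k : ℕ) (θ : Fin k → ℝ) :
    (∃ ac bc : ℕ → ℝ, ∀ y, (fun x => ∏ i, (1 - cos (x - θ i))) y
        = ∑ l ∈ range (k + 1), (ac l * cos (l * y) + bc l * sin (l * y))) := by
  have h := rootProduct_mul (const 0 1) k θ
  have e : (fun x => (∏ i, (1 - cos (x - θ i)))) = fun x => (∏ i, (1 - cos (x - θ i))) * 1 := by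
    funext x; ring
  rw [e]; simpa using h

end SoloBlindTrigPoly

open SoloBlindTrigPoly

/-- A nonnegative trigonometric polynomial vanishing at `x₀` is `(1 - cos (x - x₀))` times a
nonnegative trigonometric polynomial of degree one less. -/
theorem soloBlind_trigPoly_factor_zero {d : ℕ} {f : ℝ → ℝ} (hf : (∃ ac bc : ℕ → ℝ, ∀ y, f y
    = ∑ l ∈ range (d + 1 + 1), (ac l * cos (l * y) + bc l * sin (l * y))))
    (hpos : ∀ x, 0 ≤ f x) {x₀ : ℝ} (hx₀ : f x₀ = 0) :
    ∃ g : ℝ → ℝ, (∃ ac bc : ℕ → ℝ, ∀ y, g y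
        = ∑ l ∈ range (d + 1), (ac l * cos (l * y) + bc l * sin (l * y))) ∧ (∀ x, 0 ≤ g x) ∧
      ∀ x, f x = (1 - cos (x - x₀)) * g x := by
  have hW : (∃ ac bc : ℕ → ℝ, ∀ y, (fun x => f (x + x₀)) y
      = ∑ l ∈ range (d + 1 + 1), (ac l * cos (l * y) + bc l * sin (l * y))) := translate hf x₀
  obtain ⟨g, α, β, hg, hdec⟩ := soloBlind_trigPoly_divide hW
  -- the constant remainder vanishes because `f x₀ = 0`
  have hα : α = 0 := by
    have h0 := hdec 0
    simp only [zero_add, cos_zero, sub_self, zero_mul, sin_zero, mul_zero, add_zero] at h0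
    linarith
  -- the `sin` remainder vanishes because `x₀` is a minimum
  have hβ : β = 0 := by
    have hmin : IsLocalMin (fun x => f (x + x₀)) 0 :=
      Filter.Eventually.of_forall fun x => by
        show f (0 + x₀) ≤ f (x + x₀)
        rw [zero_add, hx₀]; exact hpos _
    obtain ⟨a', b', hg'⟩ := hg
    have hg0 := SoloBlindTrigPoly.hasDerivAt hg' 0
    have h1 : HasDerivAt (fun x => 1 - cos x) 0 0 := by
      simpa using (hasDerivAt_cos 0).const_sub 1
    have h2 := h1.mul hg0
    have hD : HasDerivAt (fun x => f (x + x₀)) β 0 := by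
      rw [show (fun x => f (x + x₀)) = _ from funext hdec]
      refine ((h2.add_const α).add ((hasDerivAt_sin 0).const_mul β)).congr_deriv ?_
      simp
    exact hmin.hasDerivAt_eq_zero hD
  subst hα hβ
  -- nonnegativity of the quotient: clear off the zero set of `1 - cos`, then by density
  have hgc : Continuous g := SoloBlindTrigPoly.continuous hg
  have hS : IsClosed {x | 0 ≤ g x} := isClosed_le continuous_const hgc
  have hsub : {x : ℝ | cos x = 1}ᶜ ⊆ {x | 0 ≤ g x} := by
    intro x hx
    have hx' : cos x ≠ 1 := hx
    have hlt : 0 < 1 - cos x := sub_pos.mpr (lt_of_le_of_ne (cos_le_one x) hx')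
    have h := hdec x
    simp only [add_zero, zero_mul] at h
    have : 0 ≤ (1 - cos x) * g x := by rw [← h]; exact hpos _
    exact nonneg_of_mul_nonneg_right (by simpa [mul_comm] using this) hlt
  have hcount : ({x : ℝ | cos x = 1}).Countable := by
    have : {x : ℝ | cos x = 1} ⊆ Set.range (fun n : ℤ => (n : ℝ) * (2 * π)) := by
      intro x hx
      obtain ⟨n, hn⟩ := (cos_eq_one_iff x).mp hx
      exact ⟨n, hn⟩
    exact (Set.countable_range _).mono this
  have hdense : Dense ({x : ℝ | cos x = 1}ᶜ) := hcount.dense_compl ℝ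
  have hall : ∀ x, 0 ≤ g x := by
    have huniv : {x | 0 ≤ g x} = Set.univ := by
      have h1 := (hdense.mono hsub).closure_eq
      rwa [hS.closure_eq] at h1
    intro x
    have : x ∈ {x | 0 ≤ g x} := by rw [huniv]; trivial
    exact this
  refine ⟨fun x => g (x - x₀), ?_, fun x => hall _, fun x => ?_⟩
  · have e : (fun x => g (x - x₀)) = fun x => g (x + (-x₀)) := by
      funext x; rw [sub_eq_add_neg]
    rw [e]; exact translate hg (-x₀)
  · have h := hdec (x - x₀)
    simp only [sub_add_cancel, add_zero, zero_mul] at h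
    exact h

/-! ### Total variation over a period: subadditivity and scaling. -/

/-- Subadditivity of `f ↦ ∫ |f′|`. -/
theorem soloBlind_tv_add_le {f g : ℝ → ℝ} (hf : Differentiable ℝ f) (hg : Differentiable ℝ g)
    (hfc : Continuous (deriv f)) (hgc : Continuous (deriv g)) {A B : ℝ} (hAB : A ≤ B) :
    (∫ x in A..B, |deriv (fun x => f x + g x) x|)
      ≤ (∫ x in A..B, |deriv f x|) + ∫ x in A..B, |deriv g x| := by
  have hd : ∀ x, deriv (fun x => f x + g x) x = deriv f x + deriv g x :=
    fun x => ((hf x).hasDerivAt.add (hg x).hasDerivAt).deriv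
  simp only [hd]
  calc (∫ x in A..B, |deriv f x + deriv g x|)
      ≤ ∫ x in A..B, (|deriv f x| + |deriv g x|) :=
        intervalIntegral.integral_mono_on hAB
          ((hfc.add hgc).abs.intervalIntegrable _ _)
          ((hfc.abs.add hgc.abs).intervalIntegrable _ _)
          (fun x _ => abs_add_le _ _)
    _ = (∫ x in A..B, |deriv f x|) + ∫ x in A..B, |deriv g x| :=
        intervalIntegral.integral_add (hfc.abs.intervalIntegrable _ _)
          (hgc.abs.intervalIntegrable _ _)

/-- Absolute homogeneity of `f ↦ ∫ |f′|`. -/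
theorem soloBlind_tv_const_mul (c : ℝ) {f : ℝ → ℝ} (hf : Differentiable ℝ f) (A B : ℝ) :
    (∫ x in A..B, |deriv (fun x => c * f x) x|) = |c| * ∫ x in A..B, |deriv f x| := by
  have hd : ∀ x, deriv (fun x => c * f x) x = c * deriv f x := fun x => deriv_const_mul c (hf x)
  simp only [hd, abs_mul]
  exact intervalIntegral.integral_const_mul _ _

/-! ### The peeling induction. -/

/-- Peeling lemma: if the circle-rooted inequality holds for all `k ≤ n`, then it holds for
`P_θ · U` whenever `P_θ` is a root product with `k` factors and `U ≥ 0` has degree `≤ n - k`. -/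
theorem soloBlind_tv_peel (n : ℕ)
    (hK : ∀ k ≤ n, ∀ θ : Fin k → ℝ,
      (∫ x in (0:ℝ)..2 * π, |deriv (fun x => ∏ i, (1 - cos (x - θ i))) x|)
        ≤ 2 * k / π * ∫ x in (0:ℝ)..2 * π, ∏ i, (1 - cos (x - θ i))) :
    ∀ j k : ℕ, k + j = n → ∀ (θ : Fin k → ℝ) (U : ℝ → ℝ),
      (∃ ac bc : ℕ → ℝ, ∀ y, U y
          = ∑ l ∈ range (j + 1), (ac l * cos (l * y) + bc l * sin (l * y))) → (∀ x, 0 ≤ U x) →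
      (∫ x in (0:ℝ)..2 * π, |deriv (fun x => (∏ i, (1 - cos (x - θ i))) * U x) x|)
        ≤ 2 * n / π * ∫ x in (0:ℝ)..2 * π, (∏ i, (1 - cos (x - θ i))) * U x := by
  have hP0 : ∀ (k : ℕ) (θ : Fin k → ℝ), 0 ≤ ∫ x in (0:ℝ)..2 * π, ∏ i, (1 - cos (x - θ i)) :=
    fun k θ => intervalIntegral.integral_nonneg (by positivity)
      fun x _ => Finset.prod_nonneg fun i _ => sub_nonneg.mpr (cos_le_one _)
  intro j
  induction j with
  | zero =>
    intro k hk θ U hU hU0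
    obtain ⟨a, b, hU⟩ := hU
    have hc : ∀ x, U x = a 0 := fun x => by rw [hU x]; simp
    have ha : 0 ≤ a 0 := by rw [← hc 0]; exact hU0 0
    have hkn : k = n := by omega
    subst hkn
    have eF : (fun x => (∏ i, (1 - cos (x - θ i))) * U x)
        = fun x => a 0 * ∏ i, (1 - cos (x - θ i)) := by
      funext x; rw [hc x]; ring
    rw [eF, soloBlind_tv_const_mul (a 0) (SoloBlindTrigPoly.differentiable (rootProduct k θ)),
      intervalIntegral.integral_const_mul, abs_of_nonneg ha]
    calc a 0 * ∫ x in (0:ℝ)..2 * π, |deriv (fun x => ∏ i, (1 - cos (x - θ i))) x|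
        ≤ a 0 * (2 * k / π * ∫ x in (0:ℝ)..2 * π, ∏ i, (1 - cos (x - θ i))) :=
          mul_le_mul_of_nonneg_left (hK k le_rfl θ) ha
      _ = 2 * k / π * (a 0 * ∫ x in (0:ℝ)..2 * π, ∏ i, (1 - cos (x - θ i))) := by ring
  | succ j ih =>
    intro k hk θ U hU hU0
    obtain ⟨x₀, hx₀⟩ := exists_forall_le hU
    have hm : 0 ≤ U x₀ := hU0 x₀
    have hV : (∃ ac bc : ℕ → ℝ, ∀ y, (fun x => U x - U x₀) y
        = ∑ l ∈ range (j + 1 + 1), (ac l * cos (l * y) + bc l * sin (l * y))) :=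
      SoloBlindTrigPoly.sub hU (SoloBlindTrigPoly.const _ _)
    have hVpos : ∀ x, 0 ≤ U x - U x₀ := fun x => sub_nonneg.mpr (hx₀ x)
    obtain ⟨W, hW, hW0, hfac⟩ :=
      soloBlind_trigPoly_factor_zero hV hVpos (x₀ := x₀) (by simp)
    -- the new root vector
    set θ' : Fin (k + 1) → ℝ := Fin.cons x₀ θ with hθ'
    have hA : (∃ ac bc : ℕ → ℝ, ∀ y, (fun x => (∏ i, (1 - cos (x - θ' i))) * W x) y
        = ∑ l ∈ range (k + 1 + j + 1), (ac l * cos (l * y) + bc l * sin (l * y))) :=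
      rootProduct_mul hW (k + 1) θ'
    have hP : (∃ ac bc : ℕ → ℝ, ∀ y, (fun x => ∏ i, (1 - cos (x - θ i))) y
        = ∑ l ∈ range (k + 1), (ac l * cos (l * y) + bc l * sin (l * y))) := rootProduct k θ
    have e : ∀ x, (∏ i, (1 - cos (x - θ i))) * U x
        = (∏ i, (1 - cos (x - θ' i))) * W x + U x₀ * ∏ i, (1 - cos (x - θ i)) := by
      intro x
      have hU' : U x = (1 - cos (x - x₀)) * W x + U x₀ := by linarith [hfac x]
      rw [hU', Fin.prod_univ_succ]
      simp only [hθ', Fin.cons_zero, Fin.cons_succ]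
      ring
    have eF : (fun x => (∏ i, (1 - cos (x - θ i))) * U x)
        = fun x => (∏ i, (1 - cos (x - θ' i))) * W x + U x₀ * ∏ i, (1 - cos (x - θ i)) :=
      funext e
    rw [eF]
    have ihA := ih (k + 1) (by omega) θ' W hW hW0
    have hB := hK k (by omega) θ
    have iA : IntervalIntegrable (fun x => (∏ i, (1 - cos (x - θ' i))) * W x)
        MeasureTheory.volume 0 (2 * π) := (SoloBlindTrigPoly.continuous hA).intervalIntegrable _ _
    have iP : IntervalIntegrable (fun x => ∏ i, (1 - cos (x - θ i)))
        MeasureTheory.volume 0 (2 * π) := (SoloBlindTrigPoly.continuous hP).intervalIntegrable _ _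
    rw [intervalIntegral.integral_add iA (iP.const_mul (U x₀)), intervalIntegral.integral_const_mul]
    have hkn : 2 * (k : ℝ) / π * (∫ x in (0:ℝ)..2 * π, ∏ i, (1 - cos (x - θ i)))
        ≤ 2 * n / π * ∫ x in (0:ℝ)..2 * π, ∏ i, (1 - cos (x - θ i)) := by
      apply mul_le_mul_of_nonneg_right _ (hP0 k θ)
      apply div_le_div_of_nonneg_right _ pi_pos.le
      have : (k : ℝ) ≤ n := by exact_mod_cast (show k ≤ n by omega)
      linarith
    calc (∫ x in (0:ℝ)..2 * π, |deriv (fun x => (∏ i, (1 - cos (x - θ' i))) * W x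
            + U x₀ * ∏ i, (1 - cos (x - θ i))) x|)
        ≤ (∫ x in (0:ℝ)..2 * π, |deriv (fun x => (∏ i, (1 - cos (x - θ' i))) * W x) x|)
          + ∫ x in (0:ℝ)..2 * π, |deriv (fun x => U x₀ * ∏ i, (1 - cos (x - θ i))) x| :=
          soloBlind_tv_add_le (SoloBlindTrigPoly.differentiable hA)
            (SoloBlindTrigPoly.differentiable (SoloBlindTrigPoly.smul (U x₀) hP))
            (SoloBlindTrigPoly.continuous_deriv hA)
            (SoloBlindTrigPoly.continuous_deriv (SoloBlindTrigPoly.smul (U x₀) hP)) (by positivity)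
      _ = (∫ x in (0:ℝ)..2 * π, |deriv (fun x => (∏ i, (1 - cos (x - θ' i))) * W x) x|)
          + |U x₀| * ∫ x in (0:ℝ)..2 * π, |deriv (fun x => ∏ i, (1 - cos (x - θ i))) x| := by
          rw [soloBlind_tv_const_mul (U x₀) (SoloBlindTrigPoly.differentiable hP)]
      _ ≤ 2 * n / π * (∫ x in (0:ℝ)..2 * π, (∏ i, (1 - cos (x - θ' i))) * W x)
          + U x₀ * (2 * k / π * ∫ x in (0:ℝ)..2 * π, ∏ i, (1 - cos (x - θ i))) := by
          rw [abs_of_nonneg hm]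
          exact add_le_add ihA (mul_le_mul_of_nonneg_left hB hm)
      _ ≤ 2 * n / π * (∫ x in (0:ℝ)..2 * π, (∏ i, (1 - cos (x - θ' i))) * W x)
          + U x₀ * (2 * n / π * ∫ x in (0:ℝ)..2 * π, ∏ i, (1 - cos (x - θ i))) :=
          add_le_add le_rfl (mul_le_mul_of_nonneg_left hkn hm)
      _ = 2 * n / π * ((∫ x in (0:ℝ)..2 * π, (∏ i, (1 - cos (x - θ' i))) * W x)
          + U x₀ * ∫ x in (0:ℝ)..2 * π, ∏ i, (1 - cos (x - θ i))) := by ring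

/-- **Reduction of THEOREM K to the circle-rooted case.**  If the total-variation inequality
`∫₀^{2π} |P'| ≤ (2k/π) ∫₀^{2π} P` holds for every root product
`P(x) = ∏_{i<k} (1 - cos (x - θ_i))` with `k ≤ n`, then
`∫₀^{2π} |T'| ≤ (2n/π) ∫₀^{2π} T` holds for every nonnegative trigonometric polynomial `T`
of degree `≤ n`. -/
theorem soloBlind_theoremK_of_circleRooted (n : ℕ)
    (hK : ∀ k ≤ n, ∀ θ : Fin k → ℝ,
      (∫ x in (0:ℝ)..2 * π, |deriv (fun x => ∏ i, (1 - Real.cos (x - θ i))) x|)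
        ≤ 2 * k / π * ∫ x in (0:ℝ)..2 * π, ∏ i, (1 - Real.cos (x - θ i)))
    (T : ℝ → ℝ) (a b : ℕ → ℝ)
    (hT : ∀ x, T x = ∑ m ∈ Finset.range (n + 1), (a m * Real.cos (m * x) + b m * Real.sin (m * x)))
    (hpos : ∀ x, 0 ≤ T x) :
    (∫ x in (0:ℝ)..2 * π, |deriv T x|) ≤ 2 * n / π * ∫ x in (0:ℝ)..2 * π, T x := by
  have h := soloBlind_tv_peel n hK n 0 (by simp) Fin.elim0 T ⟨a, b, hT⟩ hpos
  simpa only [Finset.univ_eq_empty, Finset.prod_empty, one_mul] using h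

end Summit.RiemannHypothesis.RiemannHypothesis.Theorems
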